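import Summits.BirchSwinnertonDyer.BirchSwinnertonDyer.Theorems.ResidualThetaTransportAtTwoResidualSignedLambdaLowerCMAtTwoFourTermDuality
import Summits.BirchSwinnertonDyer.BirchSwinnertonDyer.Theses.ResidualThetaTransportAtTwo
import HarnessLib

/-!
# Sketch (stub-ideation k1 g6) — STUB `stub_cmLambdaLower` = RSL_g `ResidualSignedLambdaLowerCMAtTwo` (stmt-BirchSwinnertonDyer-22608)
# of skeleton `Cruxes/ResidualThetaCountLowerPureAtTwo/Lines/bt26_lambda.lean` (crux (R≥)ᵖ stmt-BirchSwinnertonDyer-26074).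

Technique family: WEAKEN / STRENGTHEN.  Lever: **`Z := ⊤` — the zeta element never meets Poitou–Tate.**
The landed duality interface `le_finrank_baseChange_characterModule_of_duality` (…FourTermDuality, `Z : Submodule A H` arbitrary)
is specialised at the FULL Iwasawa cohomology (`range locd` in place of `Z.map locd`): the Poitou–Tate stub (rev-6 DAG stub 2)
becomes witness-free / `K0`-free / HOLD-free data `(P, pair, locd, Sel₀)` + (EH on all of `H`) + (ORTH) + (DH), and (DH) PAYS for
(i) the finiteness `K ⊗ (P ⧸ range locd)` finite (§B, B1), (ii) the non-vanishing `∃ x, locd x ≠ 0` and hence `𝔖⁺ = 0` (§B, B3–B5) —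
both bought in rev 6 from the HOLD / `(nz)` / `K0`.  The zeta element enters through ONE proved SOCKET inequality (§C):
`λ(P ⧸ locd Z) ≤ λ(P ⧸ range locd) + λ(H ⧸ Z)`, so every HOLD of the `KZ_g` family feeds the weakest sufficient input
(★) `d ≤ λ(P ⧸ range locd) + λ(X₀)` — (★) is a SOCKET, never a HOLD (k1-g4/k1-g5 dead list honoured); §A records that (★) is also
NECESSARY modulo two-sided Poitou–Tate (`finrank_add_eq_of_threeTerm_exact`).

Pure (semi)linear algebra over a commutative ring `A` with fraction field `K` (λ-currency `dim_K (K ⊗_A ·)`); nothing about curves.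
THEOREMS ONLY, NO `sorry`, no new definitions / instances / axioms.  BSD is NOT proved by any of this; 22608 / 26074 stay OPEN.
-/

set_option autoImplicit false

noncomputable section

open scoped TensorProduct Classical

namespace Summit.BirchSwinnertonDyer.BirchSwinnertonDyer.Cruxes.ResidualThetaCountLowerPureAtTwo.StubIdeasK1G6

open Summit.BirchSwinnertonDyer.BirchSwinnertonDyer.Theorems.CharIdealLambda

universe u u' v w

/-- Touchpoint: the STUB is the route decl BY NAME (never re-typed here). -/
example : Prop := Summit.BirchSwinnertonDyer.BirchSwinnertonDyer.Theses.ResidualThetaTransportAtTwo.ResidualSignedLambdaLowerCMAtTwo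

/-! ## §A  Division-ring level: additive one-sided three- and four-term counts; necessity of (★) under two-sided exactness -/

section DivisionRing

variable {L : Type u} [DivisionRing L] {V₁ Q X X₀ : Type v}
  [AddCommGroup V₁] [Module L V₁] [AddCommGroup Q] [Module L Q] [AddCommGroup X] [Module L X]
  [AddCommGroup X₀] [Module L X₀] [FiniteDimensional L V₁] [FiniteDimensional L Q]
  [FiniteDimensional L X]

/-- **A1 (additive one-sided four-term).** `ker g ≤ range f`, `range g ≤ ker h`, `h` onto ⇒
`dim Q + dim X₀ ≤ dim V₁ + dim X` (the landed `le_finrank_of_fourTerm_oneSided` is its `m`-traded corollary). [folklore] -/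
theorem finrank_add_le_of_fourTerm_oneSided (f : V₁ →ₗ[L] Q) (g : Q →ₗ[L] X) (h : X →ₗ[L] X₀)
    (hQ : LinearMap.ker g ≤ LinearMap.range f) (hX : LinearMap.range g ≤ LinearMap.ker h)
    (hh : Function.Surjective h) :
    Module.finrank L Q + Module.finrank L X₀ ≤ Module.finrank L V₁ + Module.finrank L X := by
  have h1 := g.finrank_range_add_finrank_ker
  have h2 := h.finrank_range_add_finrank_ker
  have h3 : Module.finrank L (LinearMap.ker g) ≤ Module.finrank L V₁ :=
    (Submodule.finrank_mono hQ).trans f.finrank_range_le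
  have h4 : Module.finrank L (LinearMap.range g) ≤ Module.finrank L (LinearMap.ker h) :=
    Submodule.finrank_mono hX
  have h5 : Module.finrank L (LinearMap.range h) = Module.finrank L X₀ := by
    rw [LinearMap.range_eq_top.mpr hh, finrank_top]
  omega

omit [FiniteDimensional L V₁] in
/-- **A2 (additive one-sided THREE-term = A1 at `V₁ = 0`).** `ker g = ⊥`, `range g ≤ ker h`, `h` onto ⇒
`dim Q + dim X₀ ≤ dim X`.  This is the shape the `Z = ⊤` interface produces (`Q = K ⊗ P/range locd`). [folklore] -/
theorem finrank_add_le_of_threeTerm_oneSided (g : Q →ₗ[L] X) (h : X →ₗ[L] X₀)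
    (hQ : LinearMap.ker g = ⊥) (hX : LinearMap.range g ≤ LinearMap.ker h) (hh : Function.Surjective h) :
    Module.finrank L Q + Module.finrank L X₀ ≤ Module.finrank L X := by
  have h1 := g.finrank_range_add_finrank_ker
  have h2 := h.finrank_range_add_finrank_ker
  have h3 : Module.finrank L (LinearMap.ker g) = 0 := by rw [hQ, finrank_bot]
  have h4 : Module.finrank L (LinearMap.range g) ≤ Module.finrank L (LinearMap.ker h) :=
    Submodule.finrank_mono hX
  have h5 : Module.finrank L (LinearMap.range h) = Module.finrank L X₀ := by
    rw [LinearMap.range_eq_top.mpr hh, finrank_top]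
  omega

omit [FiniteDimensional L V₁] in
/-- **A3 (necessity of (★) modulo two-sided Poitou–Tate).** If the three-term sequence is EXACT (`ker g = ⊥`,
`range g = ker h`, `h` onto) then `dim Q + dim X₀ = dim X`: so ANY hypothesis implying `d ≤ dim X` through this sequence
implies (★) `d ≤ dim Q + dim X₀` — (★) is the weakest sufficient input, not a strengthening. [folklore] -/
theorem finrank_add_eq_of_threeTerm_exact (g : Q →ₗ[L] X) (h : X →ₗ[L] X₀)
    (hQ : LinearMap.ker g = ⊥) (hX : Function.Exact g h) (hh : Function.Surjective h) :
    Module.finrank L Q + Module.finrank L X₀ = Module.finrank L X := by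
  have h1 := g.finrank_range_add_finrank_ker
  have h2 := h.finrank_range_add_finrank_ker
  have h3 : Module.finrank L (LinearMap.ker g) = 0 := by rw [hQ, finrank_bot]
  have h4 : LinearMap.ker h = LinearMap.range g := hX.linearMap_ker_eq
  have h5 : Module.finrank L (LinearMap.range h) = Module.finrank L X₀ := by
    rw [LinearMap.range_eq_top.mpr hh, finrank_top]
  rw [h4] at h2
  omega

end DivisionRing

/-! ## §B  The duality interface at `Z = ⊤` (`range locd`): what (DH) pays for -/

section Duality

variable {A : Type u} [CommRing A] (K : Type w) [Field K] [Algebra A K] [IsFractionRing A K]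
  {Sel : Type v} [AddCommGroup Sel] [Module A Sel]
  {P : Type v} [AddCommGroup P] [Module A P]
  {H : Type v} [AddCommGroup H] [Module A H]
  (pair : P →ₗ[A] CharacterModule Sel) (locd : H →ₗ[A] P) (Sel₀ : Submodule A Sel)

omit [Algebra A K] [IsFractionRing A K] in
/-- (EH) on all of `H` ⇒ `range locd ≤ ker pair` (so `ḡ : P/range locd → Sel⋆` exists). [folklore] -/
theorem range_le_ker_of_pair_locd (hEH : ∀ x : H, pair (locd x) = 0) :
    LinearMap.range locd ≤ LinearMap.ker pair := by
  rintro _ ⟨x, rfl⟩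
  exact hEH x

omit [Algebra A K] [IsFractionRing A K] in
/-- **B0.** With `Z = ⊤`, (DH) says exactly: `ker ḡ` is `A`-torsion ELEMENTWISE (no flank module `H/Z`, no `f`). [folklore] -/
theorem exists_smul_eq_zero_of_mem_ker_liftQ (hEH : ∀ x : H, pair (locd x) = 0)
    (hDH : ∀ z : P, pair z = 0 → ∃ a : A, a ≠ 0 ∧ ∃ x : H, a • z = locd x)
    (q : P ⧸ LinearMap.range locd)
    (hq : q ∈ LinearMap.ker ((LinearMap.range locd).liftQ pair (range_le_ker_of_pair_locd pair locd hEH))) :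
    ∃ a : A, a ≠ 0 ∧ a • q = 0 := by
  obtain ⟨z, rfl⟩ := Submodule.Quotient.mk_surjective _ q
  rw [LinearMap.mem_ker, Submodule.liftQ_apply] at hq
  obtain ⟨a, ha, x, hx⟩ := hDH z hq
  refine ⟨a, ha, ?_⟩
  rw [← Submodule.Quotient.mk_smul, hx, Submodule.Quotient.mk_eq_zero]
  exact ⟨x, rfl⟩

/-- **B1 (finiteness is DERIVED, not assumed).** (EH)+(DH) and `K ⊗ Sel⋆` finite-dimensional (the FINITE BRANCH of the stub)
⇒ `K ⊗ (P ⧸ range locd)` finite-dimensional — rev-6 stub 2's instance `Module.Finite K (K ⊗ (P ⧸ locd Z))` (there fed by the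
HOLD: `Col⁺(loc₂ z) ≠ 0`) is not needed at `Z = ⊤`.  (`K ⊗ ḡ` is injective by B0 + the landed torsion-tolerant descent.) [folklore] -/
theorem finite_baseChange_quotient_range_of_duality (hEH : ∀ x : H, pair (locd x) = 0)
    (hDH : ∀ z : P, pair z = 0 → ∃ a : A, a ≠ 0 ∧ ∃ x : H, a • z = locd x)
    [Module.Finite K (K ⊗[A] CharacterModule Sel)] :
    Module.Finite K (K ⊗[A] (P ⧸ LinearMap.range locd)) := by
  set g := (LinearMap.range locd).liftQ pair (range_le_ker_of_pair_locd pair locd hEH) with hg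
  have hQ : ∀ q ∈ LinearMap.ker g, ∃ a : A, a ≠ 0 ∧
      a • q ∈ LinearMap.range (0 : (P ⧸ LinearMap.range locd) →ₗ[A] (P ⧸ LinearMap.range locd)) := by
    intro q hq
    obtain ⟨a, ha, h0⟩ := exists_smul_eq_zero_of_mem_ker_liftQ pair locd hEH hDH q hq
    exact ⟨a, ha, by rw [h0]; exact zero_mem _⟩
  have hker := ker_baseChange_le_range_baseChange_of_smul_mem_range K (0 : _ →ₗ[A] _) g hQ
  have hinj : Function.Injective (g.baseChange K) := by
    rw [← LinearMap.ker_eq_bot, eq_bot_iff]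
    refine hker.trans ?_
    rw [LinearMap.baseChange_zero, LinearMap.range_zero]
  exact Module.Finite.of_injective _ hinj

/-- **B2 (THE `Z = ⊤` BOUND, additive form).** (EH on `H`), (ORTH), (DH), finite branch ⇒
`λ(P ⧸ range locd) + λ(Sel₀⋆) ≤ λ(Sel⋆)`.  No zeta element, no flank, no `K0`, no HOLD symbol in the statement; combined with
the socket (§C) and (★) it yields `d ≤ λ(Sel⋆) = λ(X⁺)`. [cite: Kobayashi2003, Thm. 7.3 ((7.21), p. 13)] [cite: MilneADT2006, Ch. I, Thm. 4.10] -/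
theorem finrank_add_le_characterModule_of_duality_top (hEH : ∀ x : H, pair (locd x) = 0)
    (horth : ∀ s ∈ Sel₀, ∀ z : P, pair z s = 0)
    (hDH : ∀ z : P, pair z = 0 → ∃ a : A, a ≠ 0 ∧ ∃ x : H, a • z = locd x)
    [Module.Finite K (K ⊗[A] CharacterModule Sel)] :
    Module.finrank K (K ⊗[A] (P ⧸ LinearMap.range locd)) + Module.finrank K (K ⊗[A] CharacterModule Sel₀)
      ≤ Module.finrank K (K ⊗[A] CharacterModule Sel) := by
  haveI : Module.Flat A K := IsLocalization.flat K (nonZeroDivisors A)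
  haveI := finite_baseChange_quotient_range_of_duality K pair locd hEH hDH
  have hle := range_le_ker_of_pair_locd pair locd hEH
  set g : (P ⧸ LinearMap.range locd) →ₗ[A] CharacterModule Sel := (LinearMap.range locd).liftQ pair hle with hg
  set h : CharacterModule Sel →ₗ[A] CharacterModule Sel₀ := CharacterModule.dual Sel₀.subtype with hh
  have hQ : ∀ q ∈ LinearMap.ker g, ∃ a : A, a ≠ 0 ∧
      a • q ∈ LinearMap.range (0 : (P ⧸ LinearMap.range locd) →ₗ[A] (P ⧸ LinearMap.range locd)) := by
    intro q hq
    obtain ⟨a, ha, h0⟩ := exists_smul_eq_zero_of_mem_ker_liftQ pair locd hEH hDH q hq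
    exact ⟨a, ha, by rw [h0]; exact zero_mem _⟩
  have hcomp : LinearMap.range g ≤ LinearMap.ker h := by
    rintro _ ⟨q, rfl⟩
    obtain ⟨z, rfl⟩ := Submodule.Quotient.mk_surjective _ q
    rw [LinearMap.mem_ker, Submodule.liftQ_apply]
    ext s
    exact horth s s.2 z
  have hhsurj : Function.Surjective h := CharacterModule.dual_surjective_of_injective _ Sel₀.injective_subtype
  set g' := g.baseChange K with hg'
  set h' := h.baseChange K with hh'
  have hh'surj : Function.Surjective h' := by
    rw [hh', LinearMap.baseChange_eq_ltensor]
    exact LinearMap.lTensor_surjective K hhsurj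
  haveI : Module.Finite K (K ⊗[A] CharacterModule Sel₀) := Module.Finite.of_surjective h' hh'surj
  have hker' : LinearMap.ker g' = ⊥ := by
    rw [eq_bot_iff]
    refine (ker_baseChange_le_range_baseChange_of_smul_mem_range K (0 : _ →ₗ[A] _) g hQ).trans ?_
    rw [LinearMap.baseChange_zero, LinearMap.range_zero]
  have hcomp' : LinearMap.range g' ≤ LinearMap.ker h' := by
    rintro _ ⟨y, rfl⟩
    have hy : (g.lTensor K) y ∈ LinearMap.ker (h.lTensor K) := range_lTensor_le_ker_lTensor K g h hcomp ⟨y, rfl⟩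
    rw [LinearMap.mem_ker] at hy ⊢
    rw [hh', hg', LinearMap.baseChange_eq_ltensor, LinearMap.baseChange_eq_ltensor]
    exact hy
  exact finrank_add_le_of_threeTerm_oneSided g' h' hker' hcomp' hh'surj

/-- **B3 ((nz)-free non-vanishing).** (EH)+(DH), finite branch, and `K ⊗ P` INFINITE-dimensional (`P ≅ Λ_𝒪`, see B3′) ⇒
`locd ≠ 0` on `H`.  (Else `range locd = ⊥` and B1 makes `K ⊗ P` finite.)  This replaces rev-6's `(nz)` («`L⁻_g ≠ 0` + ERL»)
as the source of `h𝔖`. [folklore] -/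
theorem exists_apply_ne_zero_of_duality (hEH : ∀ x : H, pair (locd x) = 0)
    (hDH : ∀ z : P, pair z = 0 → ∃ a : A, a ≠ 0 ∧ ∃ x : H, a • z = locd x)
    [Module.Finite K (K ⊗[A] CharacterModule Sel)] (hP : ¬ Module.Finite K (K ⊗[A] P)) :
    ∃ x : H, locd x ≠ 0 := by
  by_contra hzero
  push Not at hzero
  have hbot : LinearMap.range locd = ⊥ := by
    rw [eq_bot_iff]
    rintro _ ⟨x, rfl⟩
    rw [hzero x]
    exact zero_mem _
  haveI := finite_baseChange_quotient_range_of_duality K pair locd hEH hDH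
  -- `P ≃ P ⧸ ⊥ = P ⧸ range locd`, so `K ⊗ P` is finite: contradiction
  have e : P ≃ₗ[A] (P ⧸ LinearMap.range locd) :=
    (Submodule.quotEquivOfEqBot _ hbot).symm
  exact hP (Module.Finite.equiv (e.baseChange A K).symm)

end Duality

/-! ## §B′  `K ⊗_A A⟦X⟧` is infinite-dimensional (the hypothesis `hP` of B3 for `P = Λ_𝒪`) -/

section PowerSeries

variable {A : Type u} [CommRing A] (K : Type w) [Field K] [Algebra A K] [IsFractionRing A K]

omit [IsFractionRing A K] in
/-- The `K`-linear coefficient functional `K ⊗_A A⟦X⟧ → K`, `k ⊗ f ↦ k · coeff i f`. -/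
theorem baseChange_coeff_tmul (i : ℕ) (k : K) (f : PowerSeries A) :
    (TensorProduct.AlgebraTensorModule.rid A K K) ((PowerSeries.coeff i).baseChange K (k ⊗ₜ f))
      = PowerSeries.coeff i f • k := by
  rw [LinearMap.baseChange_tmul, TensorProduct.AlgebraTensorModule.rid_tmul]

omit [IsFractionRing A K] in
/-- **B3′.** `K ⊗_A A⟦X⟧` is NOT finite-dimensional over `K = Frac A`: the vectors `1 ⊗ X^j` are linearly independent
(tested against the coefficient functionals). [folklore] -/
theorem not_finite_baseChange_powerSeries : ¬ Module.Finite K (K ⊗[A] PowerSeries A) := by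
  intro hfin
  set N := Module.finrank K (K ⊗[A] PowerSeries A) with hN
  -- the family `j ↦ 1 ⊗ X^j`, `j : Fin (N+1)`
  let v : Fin (N + 1) → K ⊗[A] PowerSeries A := fun j ↦ (1 : K) ⊗ₜ (PowerSeries.X ^ (j : ℕ))
  -- the test map `Ψ : K ⊗ A⟦X⟧ → (Fin (N+1) → K)`
  let ψ : Fin (N + 1) → (K ⊗[A] PowerSeries A →ₗ[K] K) := fun i ↦
    (TensorProduct.AlgebraTensorModule.rid A K K).toLinearMap ∘ₗ (PowerSeries.coeff (i : ℕ)).baseChange K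
  let Ψ : K ⊗[A] PowerSeries A →ₗ[K] (Fin (N + 1) → K) := LinearMap.pi ψ
  have hΨ : ∀ j, Ψ (v j) = Pi.single j 1 := by
    intro j
    ext i
    simp only [Ψ, ψ, v, LinearMap.pi_apply, LinearMap.coe_comp, Function.comp_apply, LinearEquiv.coe_coe,
      baseChange_coeff_tmul, PowerSeries.coeff_X_pow]
    by_cases hij : i = j
    · subst hij; simp
    · have : (i : ℕ) ≠ (j : ℕ) := fun h ↦ hij (Fin.ext h)
      simp [this, Pi.single_eq_of_ne hij]
  have hli : LinearIndependent K v := by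
    apply LinearIndependent.of_comp Ψ
    have : Ψ ∘ v = fun j ↦ Pi.single j (1 : K) := funext hΨ
    rw [this]
    exact Pi.linearIndependent_single_one (Fin (N + 1)) K
  have := hli.fintype_card_le_finrank
  simp only [Fintype.card_fin] at this
  omega

end PowerSeries

/-! ## §B″  `𝔖⁺ = 0` HOLD-free: injectivity of `locd` from (DH) + finite branch + rank one -/

section Injective

variable {A : Type u} [CommRing A] (K : Type w) [Field K] [Algebra A K] [IsFractionRing A K]
  {R : Type u'} [CommRing R] [IsDomain R] [Algebra A R]
  {Sel : Type v} [AddCommGroup Sel] [Module A Sel]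
  {P : Type v} [AddCommGroup P] [Module A P] [Module R P] [IsScalarTower A R P]
  {H : Type v} [AddCommGroup H] [Module A H] [Module R H] [IsScalarTower A R H]

/-- **B4 (= landed N3, cited by name).** `Λ`-torsion-free `H` of rank `≤ 1`, `Λ`-torsion-free `P`, one non-zero value ⇒
`locd` injective. [cite: Kato2004Asterisque, Thm. 12.4 (2) (p. 221)] -/
theorem injective_of_rank_le_one_of_apply_ne_zero [Module.IsTorsionFree R H] [Module.IsTorsionFree R P]
    (locd : H →ₗ[R] P) (hrank : Module.rank R H ≤ 1) {x : H} (hx : locd x ≠ 0) :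
    Function.Injective locd :=
  injective_of_dep_of_apply_ne_zero locd (dep_of_rank_le_one hrank) hx

/-- **B5 (`𝔖⁺ = 0` WITHOUT `(nz)` / `(i_D)` / HOLD).** In the mixed setting (`R = Λ_𝒪` acting on `H = 𝐇¹(T_g)` and
`P = Λ_𝒪` (functional model), `A = 𝒪 ⊆ R`; `pair` only `A`-linear — the involution twist of the local Tate pairing is
irrelevant): (EH)+(DH), finite branch, `K ⊗ P` infinite-dimensional, `H` torsion-free of rank `≤ 1`, `P` torsion-free ⇒
`locd` injective, i.e. `𝔖⁺ := ker (Col⁺ ∘ loc₂) = 0`.  Feeds rev-6 stub 5 (`h𝔖`) and the Σ-part (N6) with NO input from the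
`p`-adic `L`-function. [cite: Kobayashi2003, Thm. 7.3 (proof)] [cite: Kato2004Asterisque, Thm. 12.4 (p. 221)] -/
theorem injective_locd_of_duality [Module.IsTorsionFree R H] [Module.IsTorsionFree R P]
    (pair : P →ₗ[A] CharacterModule Sel) (locd : H →ₗ[R] P)
    (hEH : ∀ x : H, pair (locd x) = 0)
    (hDH : ∀ z : P, pair z = 0 → ∃ a : A, a ≠ 0 ∧ ∃ x : H, a • z = locd x)
    [Module.Finite K (K ⊗[A] CharacterModule Sel)] (hP : ¬ Module.Finite K (K ⊗[A] P))
    (hrank : Module.rank R H ≤ 1) : Function.Injective locd := by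
  obtain ⟨x, hx⟩ := exists_apply_ne_zero_of_duality K pair (locd.restrictScalars A) hEH hDH hP
  exact injective_of_rank_le_one_of_apply_ne_zero locd hrank hx

end Injective

/-! ## §C  The SOCKET: where the zeta element meets the interface (one inequality, one place) -/

section Socket

variable {A : Type u} [CommRing A] (K : Type w) [Field K] [Algebra A K] [IsFractionRing A K]
  {P : Type v} [AddCommGroup P] [Module A P]
  {H : Type v} [AddCommGroup H] [Module A H]
  (locd : H →ₗ[A] P) (Z : Submodule A H)

/-- **C1 (socket inequality).** For ANY `Z ≤ H` (the decorated zeta span `Λ·D·z_γ`, or anything): the exact sequence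
`H/Z ↠ range locd / locd Z ↪ P / locd Z ↠ P / range locd` gives, after the flat base change `K ⊗_A ·`,
`λ(P ⧸ locd Z) ≤ λ(P ⧸ range locd) + λ(H ⧸ Z)`. [folklore] -/
theorem finrank_baseChange_quotient_map_le
    [Module.Finite K (K ⊗[A] (H ⧸ Z))] [Module.Finite K (K ⊗[A] (P ⧸ Z.map locd))] :
    Module.finrank K (K ⊗[A] (P ⧸ Z.map locd)) ≤
      Module.finrank K (K ⊗[A] (P ⧸ LinearMap.range locd)) + Module.finrank K (K ⊗[A] (H ⧸ Z)) := by
  haveI : Module.Flat A K := IsLocalization.flat K (nonZeroDivisors A)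
  have hle : Z.map locd ≤ LinearMap.range locd := LinearMap.map_le_range
  set π : (P ⧸ Z.map locd) →ₗ[A] (P ⧸ LinearMap.range locd) := Submodule.factor hle with hπ
  have hπs : Function.Surjective π := Submodule.factor_surjective hle
  set f : (H ⧸ Z) →ₗ[A] (P ⧸ Z.map locd) := Z.mapQ (Z.map locd) locd (le_comap_map_locd Z locd) with hf
  have hexact : Function.Exact f π := by
    rw [LinearMap.exact_iff, hf, Submodule.range_mapQ, hπ]
    show LinearMap.ker (Submodule.mapQ _ _ LinearMap.id hle) = _
    rw [Submodule.mapQ, Submodule.ker_liftQ, LinearMap.ker_comp, Submodule.ker_mkQ, Submodule.comap_id]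
  -- base change
  set f' := f.baseChange K with hf'
  set π' := π.baseChange K with hπ'
  have hπ's : Function.Surjective π' := by
    rw [hπ', LinearMap.baseChange_eq_ltensor]
    exact LinearMap.lTensor_surjective K hπs
  have hexact' : Function.Exact f' π' := by
    have hx := Module.Flat.lTensor_exact K hexact
    intro y
    simpa only [hf', hπ', LinearMap.baseChange_eq_ltensor] using hx y
  haveI : Module.Finite K (K ⊗[A] (P ⧸ LinearMap.range locd)) := Module.Finite.of_surjective π' hπ's
  have h1 := π'.finrank_range_add_finrank_ker
  rw [LinearMap.range_eq_top.mpr hπ's, finrank_top, hexact'.linearMap_ker_eq] at h1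
  have h2 : Module.finrank K (LinearMap.range f') ≤ Module.finrank K (K ⊗[A] (H ⧸ Z)) := f'.finrank_range_le
  omega

/-- **C2 (the socket consumes the HOLD).** The two joint HOLD clauses of the `KZ_g` family in λ-currency — (i)
`d + e ≤ λ(P ⧸ locd Z)` (membership/value clause + normλ bookkeeping, landed …FourTermOneSided §4) and (ii) `λ(H ⧸ Z) ≤ x₀ + e`
(Burungale–Tian 2.6 ⊗ℚ + decoration slack; `x₀ = λ(X_str)`) — imply the witness-free input (★) `d ≤ λ(P ⧸ range locd) + x₀`.
This is the ONLY place `z` enters; the Poitou–Tate side (§B) never sees it. [cite: BurungaleTian2026, Thm. 2.6 (p. 5)] -/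
theorem socket_of_hold [Module.Finite K (K ⊗[A] (H ⧸ Z))] [Module.Finite K (K ⊗[A] (P ⧸ Z.map locd))]
    {d e x₀ : ℕ} (hi : d + e ≤ Module.finrank K (K ⊗[A] (P ⧸ Z.map locd)))
    (hii : Module.finrank K (K ⊗[A] (H ⧸ Z)) ≤ x₀ + e) :
    d ≤ Module.finrank K (K ⊗[A] (P ⧸ LinearMap.range locd)) + x₀ := by
  have := finrank_baseChange_quotient_map_le K locd Z
  omega

end Socket

/-! ## §D  Assembly of the pieces: `d ≤ λ(Sel⋆)` from the `Z = ⊤` interface + (★) + compact PT at the strict places -/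

section Assembly

variable {A : Type u} [CommRing A] (K : Type w) [Field K] [Algebra A K] [IsFractionRing A K]
  {Sel : Type v} [AddCommGroup Sel] [Module A Sel]
  {P : Type v} [AddCommGroup P] [Module A P]
  {H : Type v} [AddCommGroup H] [Module A H]
  (pair : P →ₗ[A] CharacterModule Sel) (locd : H →ₗ[A] P) (Sel₀ : Submodule A Sel)

/-- **D1 (consumer, witness-free form).** (EH on `H`), (ORTH), (DH), finite branch, the socket output
(★) `d ≤ λ(P ⧸ range locd) + x₀` and compact Poitou–Tate at the strict places `x₀ ≤ λ(Sel₀⋆)` ⇒ `d ≤ λ(Sel⋆)`.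
(With C2 this recovers the landed `…_of_duality_decorated`; with (★) from any other source it needs no zeta element at all.)
[cite: Kobayashi2003, Thm. 7.3 ((7.21), p. 13)] -/
theorem le_finrank_characterModule_of_duality_top (hEH : ∀ x : H, pair (locd x) = 0)
    (horth : ∀ s ∈ Sel₀, ∀ z : P, pair z s = 0)
    (hDH : ∀ z : P, pair z = 0 → ∃ a : A, a ≠ 0 ∧ ∃ x : H, a • z = locd x)
    [Module.Finite K (K ⊗[A] CharacterModule Sel)] {d x₀ : ℕ}
    (hstar : d ≤ Module.finrank K (K ⊗[A] (P ⧸ LinearMap.range locd)) + x₀)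
    (hPT : x₀ ≤ Module.finrank K (K ⊗[A] CharacterModule Sel₀)) :
    d ≤ Module.finrank K (K ⊗[A] CharacterModule Sel) := by
  have := finrank_add_le_characterModule_of_duality_top K pair locd Sel₀ hEH horth hDH
  omega

/-- **D2 (by-name check that the landed `Z`-arbitrary consumer is the `m`-traded shadow of D1 + C1).** [folklore] -/
theorem le_finrank_characterModule_of_duality_via_socket (Z : Submodule A H)
    (hEH : ∀ x : H, pair (locd x) = 0) (horth : ∀ s ∈ Sel₀, ∀ z : P, pair z s = 0)
    (hDH : ∀ z : P, pair z = 0 → ∃ a : A, a ≠ 0 ∧ ∃ x : H, a • z = locd x)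
    [Module.Finite K (K ⊗[A] (H ⧸ Z))] [Module.Finite K (K ⊗[A] (P ⧸ Z.map locd))]
    [Module.Finite K (K ⊗[A] CharacterModule Sel)] {d e : ℕ}
    (hi : d + e ≤ Module.finrank K (K ⊗[A] (P ⧸ Z.map locd)))
    (hii : Module.finrank K (K ⊗[A] (H ⧸ Z)) ≤ Module.finrank K (K ⊗[A] CharacterModule Sel₀) + e) :
    d ≤ Module.finrank K (K ⊗[A] CharacterModule Sel) :=
  le_finrank_characterModule_of_duality_top K pair locd Sel₀ hEH horth hDH
    (socket_of_hold K locd Z hi hii) le_rfl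

end Assembly

end Summit.BirchSwinnertonDyer.BirchSwinnertonDyer.Cruxes.ResidualThetaCountLowerPureAtTwo.StubIdeasK1G6

end
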